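import Summits.BirchSwinnertonDyer.BirchSwinnertonDyer.Theorems.UniversalToricDescentTwinSplitIMCAtThreeGoodSSValueRoute
import Summits.BirchSwinnertonDyer.BirchSwinnertonDyer.Theorems.ClassRecordThreeBDPValueAtThreeLZZKernel
import Literature.NumberTheory.EllipticCurves.JetchevSkinnerWan2017.AnticyclotomicControlMultiplicative
import HarnessLib

/-!
# Route `UniversalToricDescent`, child `TwinSplitIMCAtThreeMult` (item stmt-BirchSwinnertonDyer-20694; bucket B =
# 675 of the 2 023 twin classes, twins with `3 ∥ N′`): the VALUE route and the UNIT TIER at a MULTIPLICATIVE twin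

Seat `bsd-wall-utd-p2` g3 (D-0131 (3) MIDDLE tier; memo `HOME/bsd-wall/bsd-wall-utd-p2/SUPSET-AT3-v6.md`). The
bucket-B instance of the value-frame kernel `…TwinSplitIMCAtThreeOfValueFrame` (p547868), mechanism of utd-idea
g3's card `steinberg-unit-display`: the ANALYTIC side costs NO port (Liu–Zhang–Zhang 2018 at `p ∥ N`, refereed,
through bsd-eis's rescale `X2.exists_continuousDisplay_of_lzzRoadInputIoo` and one-sided NORM rigidity — steps
(i)–(iii) of `LZZKernel.bdpValueAt₃_of_lzzRoadInputIoo` without its `ClassX11b` ∕ unit-period binders), CONTROL is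
Jetchev–Skinner–Wan 2017 Thm. 3.3.1 + (3.5.c) at a multiplicative `p ≥ 3` (refereed, typed
`thm331_anticyclotomicControl_mult`); what is left at a rank-one instance is ONE Howard frame (research: Howard
2004 `p ∤ N`, Castella 2018 §4 `p ≥ 5`, no admissible primes at `3`) and ONE scalar `hIdx : 2·ord₃[E′(K):ℤP] =
ord₃ #Ш(E′/K)[3^∞] + ord₃ ∏_{w split} c_w(E′/K)` (the `3`-part of the Gross–Zagier–BSD index identity for `E′/K`:
row X11b@3 territory; no Manin term as `3 ∤ c`, no anomalous term as the Steinberg factor `(1 − a₃3⁻¹)` of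
valuation `−1` is JSW's local index `3⁻¹ log_ω`); and at UNIT pairs (`ord₃ log_ω P = 1`) NO Howard frame at all —
conjuncts (i) ∧ (ii) follow from conjunct (i) ALONE, i.e. from the existence of an `R₀`-frame at `3 ∥ N′`
(x11b3's residual `BDPExistsAt₃`; Castella–Hsieh 2018 Def. 3.5 `p ∤ N`, Castella 2018 Thm. 3.1 `p ≥ 5`).

* §1 `norm_constantCoeff_eq_of_multShape` (any `p`): Steinberg bookkeeping `‖1 − a p⁻¹‖ = p`.
* §2 `norm_constantCoeff_eq_of_frame_of_mult_of_lzz`: EVERY `R₀`-frame at a multiplicative twin has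
  `‖L(0)‖ = ‖(1 − a₃3⁻¹)·log_ω P‖²` — no rank ∕ image ∕ configuration ∕ unit-period hypothesis.
* §3 `valueFrame_of_mult_of_thm331mult_of_lzz`: `Ch·R₀⟦T⟧ = (F)`, `F(0) ≠ 0`, every frame has `‖L(0)‖ = ‖F(0)‖`.
* §4 `twinSplit_instance_of_mult_of_howardFrame_of_thm331mult_of_lzz`: + ONE Howard frame ⟹ crux #3 (i) ∧ (ii)
  VERBATIM at the instance.
* §5 `twinSplit_instance_of_mult_of_frame_of_unit_…` ∕ `…_of_unitPair_…`: at a unit pair, conjunct (i) ⟹ (i) ∧ (ii).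

PARTITION currency (bucket B, 675; census QU1b first pass 10/10 unit, square-free cap 461, full run j285092): child
20694 at UNIT rank-one instances ⟸ {conjunct (i), JSW17, LZZ18}; at general rank-one instances ⟸ {Howard frame
(research), JSW17, LZZ18, `hIdx`}. Beyond-print BSD theorem: NO. `--supports stmt-BirchSwinnertonDyer-20694`.

References: [LiuZhangZhang2018] Thm. 1.5.1, Rem. 1.1.2, Thm. 1.5.3; [JetchevSkinnerWan2017] Thm. 3.3.1, Prop. 3.2.1,
(3.5.c); [Castella2018] Thm. 2.3 (`p ∣ N`), Thms. 3.1–3.2; [GrossLMS1991] Thm. 1.3 (index form of BSD over `K`).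
-/
noncomputable section

open scoped Classical Topology

set_option linter.dupNamespace false
set_option autoImplicit false

namespace Summit.BirchSwinnertonDyer.BirchSwinnertonDyer.Theorems.UniversalToricDescentTwinSplit

open Filter PowerSeries WeierstrassCurve NumberField IsDedekindDomain Field
  Literature.NumberTheory.EllipticCurves
  Literature.NumberTheory.EllipticCurves.ModularForms
  Literature.NumberTheory.EllipticCurves.Rank1Residual
  Literature.NumberTheory.EllipticCurves.JetchevSkinnerWan2017
  Literature.NumberTheory.GaloisRepresentations
  Literature.NumberTheory.GaloisCohomology
  Summit.BirchSwinnertonDyer.Rank1Residual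
  Summit.BirchSwinnertonDyer.Rank1Residual.X11b
  Summit.BirchSwinnertonDyer.Rank1Residual.X11b.Halves
  Summit.BirchSwinnertonDyer.Rank1Residual.X11b.CongruenceLimit
  Summit.BirchSwinnertonDyer.BirchSwinnertonDyer.Theorems.SchneiderFree

/-! ## §1 Steinberg bookkeeping: the value shape at a multiplicative prime (any prime) -/

section AnyPrime

variable {p : ℕ} [hp : Fact p.Prime]

/-- **`‖L(0)‖ = ‖f(0)‖` from the multiplicative value shape and the control valuation.** `f ∈ ℤ_p⟦T⟧` with
`f(0) ≠ 0` and `ord_p f(0) = 2·(ord_p x − 1)`; `L ∈ R₀⟦T⟧` with `‖L(0)‖ = ‖(1 − a p⁻¹)·x‖²`, `a = ±1`, `x ≠ 0`: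
then `‖L(0)‖ = ‖f(0)‖` in `ℂ_p` (`f(0)` read along `toUnr : ℤ_p → R₀`), because `‖1 − a p⁻¹‖ = p`
(`Halves.norm_one_sub_div_eq`). [cite: Castella2018, proof of Thm. 3.2 (arXiv:1704.06608 p. 9) (`p⁻¹(p − a_p)`)] -/
theorem norm_constantCoeff_eq_of_multShape {f : IwasawaAlgebra p} (hf0 : PowerSeries.constantCoeff f ≠ 0)
    {L : UnrSeries p} {a : ℤ} (ha : a = 1 ∨ a = -1) {x : ℚ_[p]} (hx : x ≠ 0)
    (hL : ‖((PowerSeries.constantCoeff L : unrIntegers p) : ℂ_[p])‖ =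
      ‖algebraMap ℚ_[p] ℂ_[p] (((1 : ℚ_[p]) - (a : ℚ_[p]) * (p : ℚ_[p])⁻¹) * x)‖ ^ 2)
    (hval : ((PowerSeries.constantCoeff f).valuation : ℤ) = 2 * (x.valuation - 1)) :
    ‖((PowerSeries.constantCoeff L : unrIntegers p) : ℂ_[p])‖ =
      ‖((PowerSeries.constantCoeff (PowerSeries.map (toUnr p) f) : unrIntegers p) : ℂ_[p])‖ := by
  have hp1 : (1 : ℝ) < p := by exact_mod_cast hp.out.one_lt
  have hp0 : (0 : ℝ) < p := by positivity
  have hy : ‖(1 : ℚ_[p]) - (a : ℚ_[p]) * (p : ℚ_[p])⁻¹‖ = p := Halves.norm_one_sub_div_eq (p := p) ha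
  rw [hL, norm_algebraMap', norm_mul, hy, Padic.norm_eq_zpow_neg_valuation hx, constantCoeff_map_apply,
    coe_toUnr, norm_algebraMap',
    Padic.norm_eq_zpow_neg_valuation (fun h ↦ hf0 (PadicInt.coe_eq_zero.mp h) :
      ((PowerSeries.constantCoeff f : ℤ_[p]) : ℚ_[p]) ≠ 0), PadicInt.valuation_coe, hval]
  rw [show (p : ℝ) * (p : ℝ) ^ (-x.valuation) = (p : ℝ) ^ (-x.valuation + 1) from by
      rw [zpow_add_one₀ hp0.ne', mul_comm], ← zpow_natCast, ← zpow_mul]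
  congr 1
  push_cast
  ring

end AnyPrime

/-! ## §2 `p = 3`: the value of EVERY frame at a multiplicative twin, from the refereed LZZ fact -/

section Three

variable (W' : WeierstrassCurve ℚ) [W'.IsElliptic] [W'.IsGloballyMinimal] (N' : ℕ) [NeZero N']
  (K : Type) [Field K] [NumberField K] (Dt' : ModularParametrizationData W' N')
  (κ : ZpExtension K 3) (γ : absoluteGaloisGroup K)
  (𝔭 𝔭' : HeightOneSpectrum (𝓞 K)) (ι' : PadicAlgCl 3 ≃+* ℂ)

/-- `d_K` odd, `3 ∤ d_K`, `K` imaginary quadratic ⟹ `d_K < −4`. [folklore] -/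
theorem discr_lt_neg_four_of_odd_of_not_three_dvd {K : Type} [Field K] [NumberField K]
    (hK : IsImaginaryQuadratic K) (hodd : Odd (NumberField.discr K))
    (h3 : ¬ ((3 : ℕ) : ℤ) ∣ NumberField.discr K) : NumberField.discr K < -4 := by
  have hneg : NumberField.discr K < 0 := IsImaginaryQuadratic.discr_neg hK
  have hmod4 := Literature.NumberTheory.QuadraticFields.Quadratic.discr_emod_four (K := K) hK.1
  obtain ⟨m, hm⟩ := hodd
  have hne3 : NumberField.discr K ≠ -3 := fun h ↦ h3 ⟨-1, by rw [h]; norm_num⟩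
  omega

/-- **The value at `𝟙` of EVERY `R₀`-frame at a multiplicative twin (norm form), from the REFEREED LZZ fact.**
`W′` globally minimal, MULTIPLICATIVE at `3`, conductor `N′`; `Dt′` with `3 ∤ c(Dt′)`; `K` imaginary quadratic,
Heegner for `N′`, `d_K` odd; `P ∈ E′(K)` over the Heegner point of `(Dt′, H)` along `ι_K`, of INFINITE order; `κ`
anticyclotomic with generator `γ`; `𝔭 ∋ 3` of degree one; `ι′` inducing `𝔭`. Then every frame `(Ω_K ≠ 0, Ω_p ≠ 0,
L)` with `IsBDPLFunction ι′ 𝔭 κ γ Dt′.f Ω_K Ω_p L` has `‖L(0)‖ = ‖(1 − a₃3⁻¹)·log_ω P‖²` (log at `embAt K 3 𝔭`,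
`a₃ = ±1`). No rank, image, twist or period-unit hypothesis. CONDITIONAL on the named fact `hF`.
[cite: LiuZhangZhang2018, Thm. 1.5.1 and Remark 1.1.2 and Thm. 1.5.3 (Duke Math. J. 167 (2018) pp. 745–749)]
[cite: Castella2018, Thm. 3.1–3.2 (arXiv:1704.06608 pp. 8–9) (display and value shapes)] -/
theorem norm_constantCoeff_eq_of_frame_of_mult_of_lzz
    (hF : LiuZhangZhang2018.thm151_thm153_modularCurve_heegnerVector)
    (hmult : Mult W' 3) (hN' : W'.conductorNorm ℤ = N') (hcM : ¬ (3 : ℤ) ∣ Dt'.c)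
    (hK : IsImaginaryQuadratic K) (hH : SatisfiesHeegnerHypothesis N' K) (hodd : Odd (NumberField.discr K))
    (hκ : κ.IsAnticyclotomic) [hγ : Fact (κ.IsTopGenerator γ)]
    (h𝔭 : ((3 : ℕ) : 𝓞 K) ∈ 𝔭.asIdeal) (he : 𝔭.asIdeal.ramificationIdx (𝓞 ℚ) = 1)
    (hf : 𝔭.asIdeal.inertiaDeg (𝓞 ℚ) = 1) (hι' : BranchInducesPrime 3 ι' 𝔭)
    (H : HeegnerDatum N' (NumberField.discr K)) (ιK : K →+* ℂ) (P : (W'.baseChange K).toAffine.Point)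
    (hPH : WeierstrassCurve.Affine.Point.map ιK.toRatAlgHom P = heegnerPointComplex Dt' H) (hP0 : ¬ IsOfFinAddOrder P)
    {ΩK : ℂ} {Ωp : ℂ_[3]} {L : UnrSeries 3} (hΩK : ΩK ≠ 0) (hΩp : Ωp ≠ 0)
    (hL : IsBDPLFunction ι' 𝔭 κ γ Dt'.f ΩK Ωp L) :
    ‖((PowerSeries.constantCoeff L : unrIntegers 3) : ℂ_[3])‖ =
      ‖algebraMap ℚ_[3] ℂ_[3] (((1 : ℚ_[3]) - ((W'.LFunction 3 : ℤ) : ℚ_[3]) * (3 : ℚ_[3])⁻¹) *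
        logOmega W' 3 (embAt K 3 𝔭 h𝔭 he hf) P)‖ ^ 2 := by
  have hp : (3 : ℕ).Prime := Fact.out
  -- (i) the dictionary: `3 ∣ N′`, `9 ∤ N′`, `3` split in `K`, `3 ∤ d_K`, `d_K < -4`
  have hpN : 3 ∣ N' := hN' ▸ X11b.dvd_conductorNorm_of_mult (W := W') hmult
  have hp2N : ¬ 3 ^ 2 ∣ N' := hN' ▸ X2.not_sq_dvd_conductorNorm_of_mult W' 3 hmult
  have hsplit : ((Ideal.span {((3 : ℕ) : ℤ)}).primesOver (𝓞 K)).ncard = 2 := hH 3 hp hpN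
  have hdisc : ¬ ((3 : ℕ) : ℤ) ∣ NumberField.discr K :=
    Literature.SatisfiesHeegnerHypothesis.not_dvd_discr hK.1 hH hp hpN
  have hd4 : NumberField.discr K < -4 := discr_lt_neg_four_of_odd_of_not_three_dvd hK hodd hdisc
  have hemb : ∀ k : 𝓞 K, k ∈ 𝔭.asIdeal ↔ ‖embAt K 3 𝔭 h𝔭 he hf (k : K)‖ < 1 :=
    mem_asIdeal_iff_norm_embAt_lt_one 𝔭 h𝔭 he hf
  -- the bsd-eis rescale at this datum (LZZ road)
  obtain ⟨ΩK₀, Ωp₀, u, hΩK₀, hΩp₀, hu, hcont⟩ :=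
    X2.exists_continuousDisplay_of_lzzRoadInputIoo (X2.lzzRoadInputIoo_of_thm151_thm153 hF) ι' W' K 𝔭 κ γ
      Dt' H ιK (embAt K 3 𝔭 h𝔭 he hf) P Dt'.f (by decide) hmult hN' hpN hp2N hK hd4 hsplit h𝔭 hι' hH hκ
      hγ.out Dt'.isNewformOf hcM hPH hemb
  -- (ii) the NORMS of the displays tend to `‖V‖²`
  have hVN : ∀ (φ : ℕ → HeckeCharacter K) (n : ℕ → ℕ) (r : ℕ → FramedGaloisRep K (PadicAlgCl 3) 1),
      (∀ k, 0 < n k) → (∀ k (v : HeightOneSpectrum (𝓞 K)), (φ k).IsUnramifiedAt v) →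
      (∀ k, (φ k).HasInfinityType (fun _ ↦ (n k : ℤ)) (fun _ ↦ -(n k : ℤ))) →
      (∀ k, IsPAdicAvatarOf ι' (φ k) (r k)) → (∀ k, FactorsThroughZp κ (r k)) →
      Tendsto (fun k ↦ avatarValueAt (r k) γ) atTop (𝓝 1) →
      Tendsto (fun k ↦ ‖((ι'.symm (bdpInterpolationValue 3 Dt'.f 𝔭 (φ k) (n k) ΩK₀) :
        PadicAlgCl 3) : ℂ_[3]) * Ωp₀ ^ (4 * n k)‖) atTop
        (𝓝 (‖algebraMap ℚ_[3] ℂ_[3] (((1 : ℚ_[3]) - ((W'.LFunction 3 : ℤ) : ℚ_[3]) *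
            (3 : ℚ_[3])⁻¹) * logOmega W' 3 (embAt K 3 𝔭 h𝔭 he hf) P)‖ ^ 2)) := by
    intro φ n r hn hunr hinf hav hfac hlim
    have h := (hcont φ n r hn hunr hinf hav hfac hlim).norm
    rwa [norm_mul, hu, one_mul, norm_pow, ← R1.logOmega_eq_padicLogOmega] at h
  -- the target is non-zero: `a₃ = ±1`, `log_ω P ≠ 0`
  have ha : W'.LFunction 3 = 1 ∨ W'.LFunction 3 = -1 :=
    X11b.Three.lFunction_eq_one_or_eq_neg_one_of_isNewformOf W' Dt'.isNewformOf hmult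
  have hx : ((1 : ℚ_[3]) - ((W'.LFunction 3 : ℤ) : ℚ_[3]) * (3 : ℚ_[3])⁻¹) *
      logOmega W' 3 (embAt K 3 𝔭 h𝔭 he hf) P ≠ 0 := by
    refine mul_ne_zero ?_ (R1.logOmega_ne_zero W' 3 (embAt K 3 𝔭 h𝔭 he hf) hP0)
    rcases ha with ha | ha <;> rw [ha] <;> norm_num
  have hy0' : algebraMap ℚ_[3] ℂ_[3] (((1 : ℚ_[3]) - ((W'.LFunction 3 : ℤ) : ℚ_[3]) * (3 : ℚ_[3])⁻¹) *
      logOmega W' 3 (embAt K 3 𝔭 h𝔭 he hf) P) ≠ 0 :=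
    (map_ne_zero_iff _ (algebraMap ℚ_[3] ℂ_[3]).injective).mpr hx
  have hN0 : ‖algebraMap ℚ_[3] ℂ_[3] (((1 : ℚ_[3]) - ((W'.LFunction 3 : ℤ) : ℚ_[3]) * (3 : ℚ_[3])⁻¹) *
      logOmega W' 3 (embAt K 3 𝔭 h𝔭 he hf) P)‖ ^ 2 ≠ 0 :=
    pow_ne_zero _ (norm_ne_zero_iff.mpr hy0')
  -- (iii) one-sided norm rigidity onto the given frame, read in `𝓞_{ℂ₃}⟦T⟧`
  have hQ := R1.isBDPLFunctionInt_map hL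
  have key := intSeries_norm_constantCoeff_eq_of_isBDPLFunctionInt_of_continuousNorms (p := 3) (by decide)
    hK hκ hγ.out hΩK₀ hΩK hΩp₀ hΩp hVN hN0 hQ
  have hcoe : ((PowerSeries.constantCoeff (PowerSeries.map (R1.unrToCpInt 3) L) : 𝓞_ℂ_[3]) : ℂ_[3]) =
      ((PowerSeries.constantCoeff L : unrIntegers 3) : ℂ_[3]) := by
    rw [← PowerSeries.coeff_zero_eq_constantCoeff_apply, PowerSeries.coeff_map,
      PowerSeries.coeff_zero_eq_constantCoeff_apply, R1.coe_unrToCpInt]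
  rw [hcoe] at key
  exact key

/-! ## §3 The value frame of a multiplicative twin of analytic rank one over `K`: control + LZZ + `hIdx` -/

/-- **The VALUE FRAME of a multiplicative twin of analytic rank one over `K`, from refereed print + the index
identity.** Data as in `norm_constantCoeff_eq_of_frame_of_mult_of_lzz`, plus: `ρ̄_{W′,3}` onto over `ℚ`, `𝔭′ ∋ 3`
(the STRICT prime of `X_ac`), `rank_ℤ E′(K) = 1`, `Ш(E′/K)[3^∞]` finite, and `hIdx : 2·ord₃[E′(K):ℤP] =
ord₃ #Ш(E′/K)[3^∞] + ord₃ ∏_{w ∣ N′, w split} c_w(E′/K)`. Conclusion: `Ch_Λ(X_ac(W′_K) strict at 𝔭′)·R₀⟦T⟧ = (F)`,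
`F(0) ≠ 0`, and EVERY frame `L` of `Dt′.f` at `(ι′, 𝔭)` has `‖L(0)‖ = ‖F(0)‖` (control at `𝔭′` along
`embAt K 3 𝔭′`, value at `𝔭`; the two `ord₃ log_ω P` agree by `LogSymmetry.padicLogOrd_eq_of_finrank_eq_two`).
CONDITIONAL on `h331` (JSW 2017) and `hF` (LZZ 2018).
[cite: JetchevSkinnerWan2017, Thm. 3.3.1 with Prop. 3.2.1 and §3.5 (3.5.c) (arXiv:1512.06894 pp. 10–15)]
[cite: LiuZhangZhang2018, Thm. 1.5.1 and Remark 1.1.2 and Thm. 1.5.3 (Duke Math. J. 167 (2018) pp. 745–749)]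
[cite: Castella2018, Thm. 2.3 case p ∣ N (arXiv:1704.06608 pp. 5–6)] -/
theorem valueFrame_of_mult_of_thm331mult_of_lzz
    (h331 : thm331_anticyclotomicControl_mult) (hF : LiuZhangZhang2018.thm151_thm153_modularCurve_heegnerVector)
    (hmult : Mult W' 3) (hsurj : W'.HasSurjectiveModNGaloisRep 3) (hN' : W'.conductorNorm ℤ = N') (hcM : ¬ (3 : ℤ) ∣ Dt'.c)
    (hK : IsImaginaryQuadratic K) (hH : SatisfiesHeegnerHypothesis N' K) (hodd : Odd (NumberField.discr K))
    (hκ : κ.IsAnticyclotomic) [hγ : Fact (κ.IsTopGenerator γ)]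
    (h𝔭 : ((3 : ℕ) : 𝓞 K) ∈ 𝔭.asIdeal) (he : 𝔭.asIdeal.ramificationIdx (𝓞 ℚ) = 1)
    (hf : 𝔭.asIdeal.inertiaDeg (𝓞 ℚ) = 1) (h𝔭' : ((3 : ℕ) : 𝓞 K) ∈ 𝔭'.asIdeal) (hι' : BranchInducesPrime 3 ι' 𝔭)
    (H : HeegnerDatum N' (NumberField.discr K)) (ιK : K →+* ℂ) (P : (W'.baseChange K).toAffine.Point)
    (hPH : WeierstrassCurve.Affine.Point.map ιK.toRatAlgHom P = heegnerPointComplex Dt' H) (hP0 : ¬ IsOfFinAddOrder P)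
    (hrk : (W'.baseChange K).mordellWeilRank = 1) (hfin : Finite (AddCommGroup.primaryComponent (W'.baseChange K).sha 3))
    (hIdx : 2 * (padicValNat 3 (AddSubgroup.zmultiples P).index : ℤ) =
      (padicValNat 3 (Nat.card (AddCommGroup.primaryComponent (W'.baseChange K).sha 3)) : ℤ) +
        (padicValNat 3 (splitTamagawaProduct W' K) : ℤ)) :
    ∃ F : UnrSeries 3,
      (AcSelmer.XAc.charIdeal (W'.baseChange K) 3 κ 𝔭' ∅ γ).map (PowerSeries.map (toUnr 3)) =
        Ideal.span {F} ∧
      PowerSeries.constantCoeff F ≠ 0 ∧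
      ∀ (ΩK : ℂ) (Ωp : ℂ_[3]) (L : UnrSeries 3), ΩK ≠ 0 → Ωp ≠ 0 →
        IsBDPLFunction ι' 𝔭 κ γ Dt'.f ΩK Ωp L →
        ‖((PowerSeries.constantCoeff L : unrIntegers 3) : ℂ_[3])‖ =
          ‖((PowerSeries.constantCoeff F : unrIntegers 3) : ℂ_[3])‖ := by
  have hp : (3 : ℕ).Prime := Fact.out
  have h2 : Module.finrank ℚ K = 2 := hK.1
  have hpN : 3 ∣ N' := hN' ▸ X11b.dvd_conductorNorm_of_mult (W := W') hmult
  have hspl : ((Ideal.span {((3 : ℕ) : ℤ)}).primesOver (𝓞 K)).ncard = 2 := hH 3 hp hpN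
  have hirrK : (W'.baseChange K).HasIrreducibleModPGaloisRep 3 := irrK_of_surj W' 3 hsurj K h2
  obtain ⟨he', hf'⟩ := degreeOne_of_splitsIn (p := 3) h2 hspl h𝔭'
  have hH3 : SatisfiesHeegnerHypothesis 3 K := satisfiesHeegnerHypothesis_three_of_ncard hspl
  -- the two embeddings
  set e := embAt K 3 𝔭 h𝔭 he hf with hedef
  set e' := embAt K 3 𝔭' h𝔭' he' hf' with he'def
  -- CONTROL at the strict prime `𝔭′` (JSW 3.3.1, multiplicative)
  obtain ⟨-, f₀, hf₀, hf₀0, hval⟩ := h331 W' 3 le_rfl hmult K hK hH3 hirrK e' 𝔭'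
    (mem_asIdeal_iff_norm_embAt_lt_one 𝔭' h𝔭' he' hf') κ hκ γ hrk hfin P hP0
  -- the logarithm: non-zero, valuation = padicLogOrd, same along `e` and `e'`
  have hx0 : logOmega W' 3 e P ≠ 0 := R1.logOmega_ne_zero W' 3 e hP0
  have hxval : (logOmega W' 3 e P).valuation = Literature.NumberTheory.EllipticCurves.padicLogOrd W' 3 e P := by
    rw [R1.logOmega_eq_padicLogOmega]
    exact Castella2018.valuation_padicLogOmega (by rw [← R1.logOmega_eq_padicLogOmega]; exact hx0)
  have htrans : Literature.NumberTheory.EllipticCurves.padicLogOrd W' 3 e' P =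
      Literature.NumberTheory.EllipticCurves.padicLogOrd W' 3 e P := by
    rw [← padicLogOrd_eq_literature, ← padicLogOrd_eq_literature]
    exact LogSymmetry.padicLogOrd_eq_of_finrank_eq_two W' 3 (by decide) h2 e e' hrk P hP0
  have ha : W'.LFunction 3 = 1 ∨ W'.LFunction 3 = -1 :=
    X11b.Three.lFunction_eq_one_or_eq_neg_one_of_isNewformOf W' Dt'.isNewformOf hmult
  -- assemble
  refine ⟨PowerSeries.map (toUnr 3) f₀, ?_, ?_, fun ΩK Ωp L hΩK hΩp hL ↦ ?_⟩
  · rw [xac_charIdeal_eq_literature, hf₀, map_span_singleton_powerSeries]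
  · rw [constantCoeff_map_apply]
    intro h0
    apply hf₀0
    have h1 : ((toUnr 3 (PowerSeries.constantCoeff f₀) : unrIntegers 3) : ℂ_[3]) = 0 := by
      rw [h0]; rfl
    rw [coe_toUnr] at h1
    have h2' : ((PowerSeries.constantCoeff f₀ : ℤ_[3]) : ℚ_[3]) = 0 :=
      (algebraMap ℚ_[3] ℂ_[3]).injective (by rw [h1, map_zero])
    exact PadicInt.coe_eq_zero.mp h2'
  · have hLn := norm_constantCoeff_eq_of_frame_of_mult_of_lzz W' N' K Dt' κ γ 𝔭 ι' hF hmult hN' hcM hK hH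
      hodd hκ h𝔭 he hf hι' H ιK P hPH hP0 hΩK hΩp hL
    refine norm_constantCoeff_eq_of_multShape hf₀0 ha hx0 hLn ?_
    rw [hval, htrans, ← hxval]
    linarith [hIdx]

/-! ## §4 Child `TwinSplitIMCAtThreeMult` at rank-one instances from ONE Howard frame + print + `hIdx` -/

/-- **Crux #3 VERBATIM at a multiplicative twin of analytic rank one over `K`, from ONE Howard frame, refereed
print and the index identity.** Data of §3 plus `hHow`: SOME frame `L₁` of `Dt′.f` at `(ι′, 𝔭)` lies in
`Ch_Λ(X_ac(W′_K) strict at 𝔭′)·R₀⟦T⟧` (Howard direction at a MULTIPLICATIVE `3` — not in print: Howard 2004 `p ∤ N`,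
Castella 2018 §4 `p ≥ 5`, no admissible primes at `3`). Conclusion: conjuncts (i) ∧ (ii) of `TwinSplitIMCAtThree`
at `(W′, N′, K, Dt′, κ, γ, 𝔭, 𝔭′, ι′)` (by `twinSplit_instance_of_howardFrame_of_valueFrame`, p547868; the value of
the Howard frame itself is read by §2). CONDITIONAL on `h331`, `hF`, `hHow`, `hIdx`. [cite: JetchevSkinnerWan2017, Thm. 3.3.1 with §3.5 (3.5.c) (arXiv:1512.06894 pp. 11, 15)]
[cite: LiuZhangZhang2018, Thm. 1.5.1 and Thm. 1.5.3 (Duke Math. J. 167 pp. 748–749)]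
[cite: Castella2018, Thm. 3.1 and §4 Thm. 4.4 (arXiv:1704.06608 pp. 9, 11) (frame predicate; the p ≥ 5 Howard direction)] -/
theorem twinSplit_instance_of_mult_of_howardFrame_of_thm331mult_of_lzz
    (h331 : thm331_anticyclotomicControl_mult) (hF : LiuZhangZhang2018.thm151_thm153_modularCurve_heegnerVector)
    (hmult : Mult W' 3) (hsurj : W'.HasSurjectiveModNGaloisRep 3) (hN' : W'.conductorNorm ℤ = N') (hcM : ¬ (3 : ℤ) ∣ Dt'.c)
    (hK : IsImaginaryQuadratic K) (hH : SatisfiesHeegnerHypothesis N' K) (hodd : Odd (NumberField.discr K))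
    (hκ : κ.IsAnticyclotomic) [hγ : Fact (κ.IsTopGenerator γ)]
    (h𝔭 : ((3 : ℕ) : 𝓞 K) ∈ 𝔭.asIdeal) (he : 𝔭.asIdeal.ramificationIdx (𝓞 ℚ) = 1)
    (hf : 𝔭.asIdeal.inertiaDeg (𝓞 ℚ) = 1) (h𝔭' : ((3 : ℕ) : 𝓞 K) ∈ 𝔭'.asIdeal) (hι' : BranchInducesPrime 3 ι' 𝔭)
    (H : HeegnerDatum N' (NumberField.discr K)) (ιK : K →+* ℂ) (P : (W'.baseChange K).toAffine.Point)
    (hPH : WeierstrassCurve.Affine.Point.map ιK.toRatAlgHom P = heegnerPointComplex Dt' H) (hP0 : ¬ IsOfFinAddOrder P)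
    (hrk : (W'.baseChange K).mordellWeilRank = 1) (hfin : Finite (AddCommGroup.primaryComponent (W'.baseChange K).sha 3))
    (hIdx : 2 * (padicValNat 3 (AddSubgroup.zmultiples P).index : ℤ) =
      (padicValNat 3 (Nat.card (AddCommGroup.primaryComponent (W'.baseChange K).sha 3)) : ℤ) +
        (padicValNat 3 (splitTamagawaProduct W' K) : ℤ))
    (hHow : ∃ (ΩK : ℂ) (Ωp : ℂ_[3]) (L : UnrSeries 3), ΩK ≠ 0 ∧ Ωp ≠ 0 ∧
      IsBDPLFunction ι' 𝔭 κ γ Dt'.f ΩK Ωp L ∧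
      L ∈ (AcSelmer.XAc.charIdeal (W'.baseChange K) 3 κ 𝔭' ∅ γ).map (PowerSeries.map (toUnr 3))) :
    (∃ (ΩK : ℂ) (Ωp : ℂ_[3]) (L' : UnrSeries 3), ΩK ≠ 0 ∧ Ωp ≠ 0 ∧
        IsBDPLFunction ι' 𝔭 κ γ Dt'.f ΩK Ωp L') ∧
      (∀ (ΩK : ℂ) (Ωp : ℂ_[3]) (L' : UnrSeries 3), ΩK ≠ 0 → Ωp ≠ 0 →
        IsBDPLFunction ι' 𝔭 κ γ Dt'.f ΩK Ωp L' →
        (AcSelmer.XAc.charIdeal (W'.baseChange K) 3 κ 𝔭' ∅ γ).map (PowerSeries.map (toUnr 3)) =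
          Ideal.span {L'}) := by
  obtain ⟨F, hCh, hF0, hVal⟩ := valueFrame_of_mult_of_thm331mult_of_lzz W' N' K Dt' κ γ 𝔭 𝔭' ι' h331 hF
    hmult hsurj hN' hcM hK hH hodd hκ h𝔭 he hf h𝔭' hι' H ιK P hPH hP0 hrk hfin hIdx
  obtain ⟨ΩK₁, Ωp₁, L₁, hΩK₁, hΩp₁, hL₁, hmem⟩ := hHow
  exact twinSplit_instance_of_howardFrame_of_valueFrame W' N' K Dt' κ γ 𝔭 𝔭' ι' hK hκ hCh hF0
    ⟨ΩK₁, Ωp₁, L₁, hΩK₁, hΩp₁, hL₁, hmem⟩ ⟨ΩK₁, Ωp₁, L₁, hΩK₁, hΩp₁, hL₁, hVal ΩK₁ Ωp₁ L₁ hΩK₁ hΩp₁ hL₁⟩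

/-! ## §5 THE UNIT TIER: at `ord₃ log_ω P = 1` conjunct (i) ALONE gives (i) ∧ (ii) (+ print + `hIdx`) -/

/-- **Crux #3 VERBATIM at a multiplicative twin over a UNIT pair, from conjunct (i) ALONE (+ refereed print +
`hIdx`) — NO Howard frame.** Same data as `valueFrame_of_mult_of_thm331mult_of_lzz` plus the unit clause
`‖log_ω P‖ = 3⁻¹` at `embAt K 3 𝔭` (`ord₃ log_ω P = 1`, the least possible value at a multiplicative `3`) and
conjunct (i) itself (`hFr`: SOME `R₀`-frame of `Dt′.f` at `(ι′, 𝔭)` exists — the `R₀`-DESCENT at `3 ∥ N′`, x11b3's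
residual `BDPExistsAt₃`; not in print: Castella–Hsieh 2018 Def. 3.5 `p ∤ N`, Castella 2018 Thm. 3.1 `p ≥ 5`).
Then every frame has `‖L(0)‖ = ‖(1 − a₃3⁻¹)‖²·‖log_ω P‖² = 9·9⁻¹ = 1`, so `(L) = ⊤`; the generator `F` of
`Ch·R₀⟦T⟧` has `‖F(0)‖ = ‖L(0)‖ = 1`, so `Ch·R₀⟦T⟧ = ⊤` as well; (ii) reads `⊤ = ⊤` at every frame. Formally:
the frame of `hFr` is a Howard frame for free (`⊤ ∋ L`), then §4. CONDITIONAL on `h331`, `hF`, `hFr`, `hIdx`.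
[cite: JetchevSkinnerWan2017, Thm. 3.3.1 with §3.5 (3.5.c) (arXiv:1512.06894 pp. 11, 15)]
[cite: LiuZhangZhang2018, Thm. 1.5.1 and Thm. 1.5.3 (Duke Math. J. 167 pp. 748–749)] -/
theorem twinSplit_instance_of_mult_of_frame_of_unit_of_thm331mult_of_lzz
    (h331 : thm331_anticyclotomicControl_mult) (hF : LiuZhangZhang2018.thm151_thm153_modularCurve_heegnerVector)
    (hmult : Mult W' 3) (hsurj : W'.HasSurjectiveModNGaloisRep 3) (hN' : W'.conductorNorm ℤ = N') (hcM : ¬ (3 : ℤ) ∣ Dt'.c)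
    (hK : IsImaginaryQuadratic K) (hH : SatisfiesHeegnerHypothesis N' K) (hodd : Odd (NumberField.discr K))
    (hκ : κ.IsAnticyclotomic) [hγ : Fact (κ.IsTopGenerator γ)]
    (h𝔭 : ((3 : ℕ) : 𝓞 K) ∈ 𝔭.asIdeal) (he : 𝔭.asIdeal.ramificationIdx (𝓞 ℚ) = 1)
    (hf : 𝔭.asIdeal.inertiaDeg (𝓞 ℚ) = 1) (h𝔭' : ((3 : ℕ) : 𝓞 K) ∈ 𝔭'.asIdeal) (hι' : BranchInducesPrime 3 ι' 𝔭)
    (H : HeegnerDatum N' (NumberField.discr K)) (ιK : K →+* ℂ) (P : (W'.baseChange K).toAffine.Point)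
    (hPH : WeierstrassCurve.Affine.Point.map ιK.toRatAlgHom P = heegnerPointComplex Dt' H) (hP0 : ¬ IsOfFinAddOrder P)
    (hrk : (W'.baseChange K).mordellWeilRank = 1) (hfin : Finite (AddCommGroup.primaryComponent (W'.baseChange K).sha 3))
    (hIdx : 2 * (padicValNat 3 (AddSubgroup.zmultiples P).index : ℤ) =
      (padicValNat 3 (Nat.card (AddCommGroup.primaryComponent (W'.baseChange K).sha 3)) : ℤ) +
        (padicValNat 3 (splitTamagawaProduct W' K) : ℤ))
    (hlog : ‖logOmega W' 3 (embAt K 3 𝔭 h𝔭 he hf) P‖ = (3 : ℝ)⁻¹)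
    (hFr : ∃ (ΩK : ℂ) (Ωp : ℂ_[3]) (L : UnrSeries 3), ΩK ≠ 0 ∧ Ωp ≠ 0 ∧
      IsBDPLFunction ι' 𝔭 κ γ Dt'.f ΩK Ωp L) :
    (∃ (ΩK : ℂ) (Ωp : ℂ_[3]) (L' : UnrSeries 3), ΩK ≠ 0 ∧ Ωp ≠ 0 ∧
        IsBDPLFunction ι' 𝔭 κ γ Dt'.f ΩK Ωp L') ∧
      (∀ (ΩK : ℂ) (Ωp : ℂ_[3]) (L' : UnrSeries 3), ΩK ≠ 0 → Ωp ≠ 0 →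
        IsBDPLFunction ι' 𝔭 κ γ Dt'.f ΩK Ωp L' →
        (AcSelmer.XAc.charIdeal (W'.baseChange K) 3 κ 𝔭' ∅ γ).map (PowerSeries.map (toUnr 3)) =
          Ideal.span {L'}) := by
  obtain ⟨F, hCh, hF0, hVal⟩ := valueFrame_of_mult_of_thm331mult_of_lzz W' N' K Dt' κ γ 𝔭 𝔭' ι' h331 hF
    hmult hsurj hN' hcM hK hH hodd hκ h𝔭 he hf h𝔭' hι' H ιK P hPH hP0 hrk hfin hIdx
  obtain ⟨ΩK₁, Ωp₁, L₁, hΩK₁, hΩp₁, hL₁⟩ := hFr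
  -- every frame has a norm-one constant term: `‖(1 − a₃3⁻¹)·log_ω P‖² = (3·3⁻¹)² = 1`
  have ha : W'.LFunction 3 = 1 ∨ W'.LFunction 3 = -1 :=
    X11b.Three.lFunction_eq_one_or_eq_neg_one_of_isNewformOf W' Dt'.isNewformOf hmult
  have hL₁n : ‖((PowerSeries.constantCoeff L₁ : unrIntegers 3) : ℂ_[3])‖ = 1 := by
    rw [norm_constantCoeff_eq_of_frame_of_mult_of_lzz W' N' K Dt' κ γ 𝔭 ι' hF hmult hN' hcM hK hH hodd hκ h𝔭
      he hf hι' H ιK P hPH hP0 hΩK₁ hΩp₁ hL₁, norm_algebraMap', norm_mul, hlog,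
      show ‖(1 : ℚ_[3]) - ((W'.LFunction 3 : ℤ) : ℚ_[3]) * (3 : ℚ_[3])⁻¹‖ = (3 : ℕ) from
        Halves.norm_one_sub_div_eq (p := 3) ha]
    norm_num
  -- hence `F(0)` is a unit and `Ch·R₀⟦T⟧ = ⊤ ∋ L₁`: a Howard frame for free
  have hFu : IsUnit F := by
    rw [PowerSeries.isUnit_iff_constantCoeff, unrIntegers.isUnit_iff_norm_eq_one, ← hVal ΩK₁ Ωp₁ L₁ hΩK₁ hΩp₁ hL₁]
    exact hL₁n
  have htop : (AcSelmer.XAc.charIdeal (W'.baseChange K) 3 κ 𝔭' ∅ γ).map (PowerSeries.map (toUnr 3)) = ⊤ := by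
    rw [hCh, Ideal.span_singleton_eq_top]
    exact hFu
  have hmem : L₁ ∈ (AcSelmer.XAc.charIdeal (W'.baseChange K) 3 κ 𝔭' ∅ γ).map (PowerSeries.map (toUnr 3)) := by
    rw [htop]; exact Submodule.mem_top
  exact twinSplit_instance_of_howardFrame_of_valueFrame W' N' K Dt' κ γ 𝔭 𝔭' ι' hK hκ hCh hF0
    ⟨ΩK₁, Ωp₁, L₁, hΩK₁, hΩp₁, hL₁, hmem⟩ ⟨ΩK₁, Ωp₁, L₁, hΩK₁, hΩp₁, hL₁, hVal ΩK₁ Ωp₁ L₁ hΩK₁ hΩp₁ hL₁⟩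

/-- **The census form of the unit tier** (QU1b's unit flag): `3 ∤ #Ш(E′/K)[3^∞]`, `3 ∤ ∏_{w split} c_w(E′/K)`,
`3 ∤ [E′(K):ℤ·P]`, `ord₃ log_ω P = 1` — `hIdx` reads `0 = 0 + 0` and §5 applies: at the instance, conjunct (i) ⟹
(i) ∧ (ii), granted JSW17 (mult.) and LZZ18. (On bucket B, `ρ̄₃|_{D₃}` très ramifié, `3 ∤ c₃(E′)` always, so
`3 ∤ ∏ c_w` only constrains `ℓ ≠ 3`.) CONDITIONAL on `h331`, `hF`, `hFr`. [cite: JetchevSkinnerWan2017, Thm. 3.3.1 with §3.5 (3.5.c) (arXiv:1512.06894 pp. 11, 15)]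
[cite: LiuZhangZhang2018, Thm. 1.5.1 and Thm. 1.5.3 (Duke Math. J. 167 pp. 748–749)] -/
theorem twinSplit_instance_of_mult_of_frame_of_unitPair_of_thm331mult_of_lzz
    (h331 : thm331_anticyclotomicControl_mult) (hF : LiuZhangZhang2018.thm151_thm153_modularCurve_heegnerVector)
    (hmult : Mult W' 3) (hsurj : W'.HasSurjectiveModNGaloisRep 3) (hN' : W'.conductorNorm ℤ = N') (hcM : ¬ (3 : ℤ) ∣ Dt'.c)
    (hK : IsImaginaryQuadratic K) (hH : SatisfiesHeegnerHypothesis N' K) (hodd : Odd (NumberField.discr K))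
    (hκ : κ.IsAnticyclotomic) [hγ : Fact (κ.IsTopGenerator γ)]
    (h𝔭 : ((3 : ℕ) : 𝓞 K) ∈ 𝔭.asIdeal) (he : 𝔭.asIdeal.ramificationIdx (𝓞 ℚ) = 1)
    (hf : 𝔭.asIdeal.inertiaDeg (𝓞 ℚ) = 1) (h𝔭' : ((3 : ℕ) : 𝓞 K) ∈ 𝔭'.asIdeal) (hι' : BranchInducesPrime 3 ι' 𝔭)
    (H : HeegnerDatum N' (NumberField.discr K)) (ιK : K →+* ℂ) (P : (W'.baseChange K).toAffine.Point)
    (hPH : WeierstrassCurve.Affine.Point.map ιK.toRatAlgHom P = heegnerPointComplex Dt' H) (hP0 : ¬ IsOfFinAddOrder P)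
    (hrk : (W'.baseChange K).mordellWeilRank = 1) (hfin : Finite (AddCommGroup.primaryComponent (W'.baseChange K).sha 3))
    (hSha : ¬ 3 ∣ Nat.card (AddCommGroup.primaryComponent (W'.baseChange K).sha 3))
    (hTam : ¬ 3 ∣ splitTamagawaProduct W' K)
    (hInd : ¬ 3 ∣ (AddSubgroup.zmultiples P).index)
    (hlog : ‖logOmega W' 3 (embAt K 3 𝔭 h𝔭 he hf) P‖ = (3 : ℝ)⁻¹)
    (hFr : ∃ (ΩK : ℂ) (Ωp : ℂ_[3]) (L : UnrSeries 3), ΩK ≠ 0 ∧ Ωp ≠ 0 ∧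
      IsBDPLFunction ι' 𝔭 κ γ Dt'.f ΩK Ωp L) :
    (∃ (ΩK : ℂ) (Ωp : ℂ_[3]) (L' : UnrSeries 3), ΩK ≠ 0 ∧ Ωp ≠ 0 ∧
        IsBDPLFunction ι' 𝔭 κ γ Dt'.f ΩK Ωp L') ∧
      (∀ (ΩK : ℂ) (Ωp : ℂ_[3]) (L' : UnrSeries 3), ΩK ≠ 0 → Ωp ≠ 0 →
        IsBDPLFunction ι' 𝔭 κ γ Dt'.f ΩK Ωp L' →
        (AcSelmer.XAc.charIdeal (W'.baseChange K) 3 κ 𝔭' ∅ γ).map (PowerSeries.map (toUnr 3)) =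
          Ideal.span {L'}) := by
  have h1 : padicValNat 3 (Nat.card (AddCommGroup.primaryComponent (W'.baseChange K).sha 3)) = 0 :=
    padicValNat.eq_zero_of_not_dvd hSha
  have h2 : padicValNat 3 (splitTamagawaProduct W' K) = 0 := padicValNat.eq_zero_of_not_dvd hTam
  have h3 : padicValNat 3 (AddSubgroup.zmultiples P).index = 0 := padicValNat.eq_zero_of_not_dvd hInd
  exact twinSplit_instance_of_mult_of_frame_of_unit_of_thm331mult_of_lzz W' N' K Dt' κ γ 𝔭 𝔭' ι' h331 hF hmult
    hsurj hN' hcM hK hH hodd hκ h𝔭 he hf h𝔭' hι' H ιK P hPH hP0 hrk hfin (by rw [h1, h2, h3]; simp) hlog hFr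

end Three

end Summit.BirchSwinnertonDyer.BirchSwinnertonDyer.Theorems.UniversalToricDescentTwinSplit

end
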